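import Mathlib
import HarnessLib
import Summits.HubbardSuperconductivity.HubbardSuperconductivity.Theorems.KLProgrammePerturbedFermiCurveSlopeNormalForm
import Summits.HubbardSuperconductivity.HubbardSuperconductivity.Theorems.KLProgrammePerturbedFermiCurveGaussMapHalfTorus
import Summits.HubbardSuperconductivity.HubbardSuperconductivity.Theorems.KLProgrammeKLRegimeTwoPointLimitShellCountCooper

/-!
# Route `KLProgramme` — ENGINE child (stmt-HubbardSuperconductivity-20437 `KLRegimeEngineV17F2`): the ANGLE ALTERNATIVE on the frame's Fermi curve —
# a small crossing slope at `(φ, θ)` forces `θ ≡ φ` or `θ ≡ φ + π` on the torus, quantitatively (step (T1) of the `TwoShellFrameAreaAt` witness,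
# design note HOME/hubbard-kl-k3c2-p2/TWO-SHELL-FRAME-PORT.md §3; frame analogue of the dichotomy inside p1b's `klst_transversality_alternative`)

Cell `gate-hubbard-kl`, seat hubbard-kl-k3c2-p2 g15; assembles `abs_slopeForm_tangent_ge` (`…SlopeNormalForm`), the mod-π injectivity modulus of the Gauss map
(`normalAngleFn_halfTorus_ge_of_geomConstants`, `…GaussMapHalfTorus`) and Jordan's inequality:
* §1 Jordan `dist(x, πℤ) ≤ (π/2)|sin x|` = p1b's `klcc_exists_int_abs_sub_mul_pi_le` (reused, not restated);
* §2 **`angle_alternative_of_geomConstants`** — two root selections `u₁` (level `ν₁`, where the translated point sits) and `u₂` (level `ν₂`, `π`-periodic, the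
  parametrised curve; `|ν₂ − μ| < r₀`) of the SAME frame `δ_K = −K.eval` (C⁰/C¹ binders `κ₀`, `κ₁ < Dt_min`; `GeomConstants (frameLevel μ K) Kc r₀ g₀ w`):
  `c_K·min(‖φ − θ‖_𝕋, ‖φ − θ − π‖_𝕋) ≤ (π/2)·|ℓ_{p₁(φ)}(v₂(θ))|/((Dt_min − κ₁)·u_min) + |α₁(φ) − α₂(φ)|`, `c_K = u_min·w/(4 + κ₁)`,
  where `ℓ_{p₁(φ)}(v₂(θ)) = DE(p₁(φ))[p₂′(θ)]` is the crossing slope (`= De_K(toLp p₁(φ))[toLp p₂′(θ)]`, `fderiv_frameLevel_toLp`) and the last term is the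
  normal-angle discrepancy of the two LEVELS at the same angle (`O(|ν₁ − ν₂|)`, the level-Lipschitz lemma — next brick).
READING for (T1): with `q = p₂(θ) − w` reduced to the cell, `q = p₁(φ)` on its own level `ν₁ = μ + e_K(q)` (ray uniqueness); `G′(θ) = ℓ_{p₁(φ)}(v₂(θ))`; so
`|G(θ)| ≤ η`, `|G′(θ)| ≤ λ` ⇒ `min(‖φ−θ‖_𝕋, ‖φ−θ−π‖_𝕋) = O(λ + η + |e|)`: `φ ≈ θ` (COOPER, `w ≈ 0 mod 2πℤ²`) or `φ ≈ θ + π` (CAUSTIC, `w ≈ 2p₂(θ)`).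
Everything is PROVED; no definitions, no named facts; nothing asserts any stub or superconductivity.
References: BGM 2003 §7.1 Lemma 7.1 (A1.9) [cite: BenfattoGiulianiMastropietro2003]; FST II App. B [cite: FeldmanSalmhoferTrubowitz1998].
-/

noncomputable section

namespace Summit.HubbardSuperconductivity.HubbardSuperconductivity.Theorems.PerturbedFermiCurve

set_option linter.dupNamespace false -- summit = problem name (single-conjunct summit), D-0017

open Real Set
open Literature.MathematicalPhysics.QuantumLattice Literature.MathematicalPhysics.QuantumLattice.BandSectorCounting
open Literature.MathematicalPhysics.QuantumLattice.FermiRG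
open Summit.HubbardSuperconductivity.HubbardSuperconductivity.Theorems.DispersionFlow
open Summit.HubbardSuperconductivity.HubbardSuperconductivity.Theorems.KLRegimeSplit

/-! ## §1 Jordan: `dist(x, πℤ) ≤ (π/2)|sin x|` is p1b's `klcc_exists_int_abs_sub_mul_pi_le` (`…TwoPointLimitShellCountCooper`), reused below. -/

/-! ## §2 The angle alternative -/

section Frame

variable {a b : ℝ} (B : BandBounds a b) {K : TrigPolyC4v} {κ₀ κ₁ : ℝ}
  (hδ : ∀ k : Fin 2 → ℝ, (∀ i, |k i| ≤ π) → |(fun k : Fin 2 → ℝ => -K.eval k) k| ≤ κ₀)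
  (hκ : ∀ k : Fin 2 → ℝ, (∀ i, |k i| ≤ π) → ‖fderiv ℝ (fun k : Fin 2 → ℝ => -K.eval k) k‖ ≤ κ₁) (hκ₁ : κ₁ < B.Dtmin)
  {μ Kc r₀ g₀ w : ℝ} (hG : GeomConstants (frameLevel μ K) Kc r₀ g₀ w)
  {ν₁ : ℝ} (hlo₁ : a ≤ ν₁ - κ₀) (hhi₁ : ν₁ + κ₀ ≤ b) {u₁ : ℝ → ℝ}
  (hu₁ : ∀ θ, IsBandFermiRadius (ν₁ - (fun k : Fin 2 → ℝ => -K.eval k) (u₁ θ • dir θ)) θ (u₁ θ))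
  {ν₂ : ℝ} (hlo₂ : a ≤ ν₂ - κ₀) (hhi₂ : ν₂ + κ₀ ≤ b) {u₂ : ℝ → ℝ}
  (hu₂ : ∀ θ, IsBandFermiRadius (ν₂ - (fun k : Fin 2 → ℝ => -K.eval k) (u₂ θ • dir θ)) θ (u₂ θ)) (hper₂ : Function.Periodic u₂ π)
  (hν₂ : |ν₂ - μ| < r₀)
include B hδ hκ hκ₁ hG hlo₁ hhi₁ hu₁ hlo₂ hhi₂ hu₂ hper₂ hν₂

/-- **Angle alternative**: a crossing slope `ℓ_{p₁(φ)}(v₂(θ))` of the level-`ν₂` curve's tangent at `θ` against the gradient at the level-`ν₁` point of angle `φ`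
controls the torus distance of `θ` to `{φ, φ + π}`:
`c_K·min(‖φ − θ‖_𝕋, ‖φ − θ − π‖_𝕋) ≤ (π/2)·|ℓ|/((Dt_min − κ₁)·u_min) + |α₁(φ) − α₂(φ)|`, `c_K = u_min·w/(4 + κ₁)`.
[cite: BenfattoGiulianiMastropietro2003, §7.1 Lemma 7.1 (A1.9)] -/
theorem angle_alternative_of_geomConstants (φ θ : ℝ) :
    B.umin * w / (4 + κ₁) * min (torusDist (φ - θ)) (torusDist (φ - θ - π)) ≤
      π / 2 * |2 * Real.sin (XE u₁ φ) * VXE u₂ θ + 2 * Real.sin (YE u₁ φ) * VYE u₂ θ +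
          fderiv ℝ (fun k : Fin 2 → ℝ => -K.eval k) (u₁ φ • dir φ) ![VXE u₂ θ, VYE u₂ θ]| / ((B.Dtmin - κ₁) * B.umin) +
        |(φ - Real.arctan (deriv u₁ φ / u₁ φ)) - (φ - Real.arctan (deriv u₂ φ / u₂ φ))| := by
  have hδs : ContDiff ℝ 2 (fun k : Fin 2 → ℝ => -K.eval k) := contDiff_frameShift_toLp K
  set ℓ := 2 * Real.sin (XE u₁ φ) * VXE u₂ θ + 2 * Real.sin (YE u₁ φ) * VYE u₂ θ +
      fderiv ℝ (fun k : Fin 2 → ℝ => -K.eval k) (u₁ φ • dir φ) ![VXE u₂ θ, VYE u₂ θ] with hℓ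
  set x := (φ - Real.arctan (deriv u₁ φ / u₁ φ)) - (θ - Real.arctan (deriv u₂ θ / u₂ θ)) with hx
  have hD : 0 < (B.Dtmin - κ₁) * B.umin := mul_pos (sub_pos.2 hκ₁) B.umin_pos
  -- the slope controls `|sin x|`
  have hu₂min : B.umin ≤ u₂ θ := umin_le_of_shifted B hδ hlo₂ hhi₂ (hu₂ θ)
  have hslope : (B.Dtmin - κ₁) * B.umin * |Real.sin x| ≤ |ℓ| :=
    abs_slopeForm_tangent_ge B hδs hδ hlo₁ hhi₁ hκ hκ₁ hu₁ φ θ hu₂min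
  have hsin : |Real.sin x| ≤ |ℓ| / ((B.Dtmin - κ₁) * B.umin) := by
    rw [le_div_iff₀ hD]; linarith
  -- Jordan: `x` is `(π/2)|sin x|`-close to some `kπ`
  obtain ⟨k, hk⟩ := klcc_exists_int_abs_sub_mul_pi_le x
  -- half-torus expansion of the SECOND curve's Gauss map at `(φ, θ)`
  have hexp := normalAngleFn_halfTorus_ge_of_geomConstants B hδ hlo₂ hhi₂ hκ hκ₁ hG hν₂ hu₂ hper₂ φ θ k
  -- triangle inequality through `α₁(φ)`
  have htri : |(φ - Real.arctan (deriv u₂ φ / u₂ φ)) - (θ - Real.arctan (deriv u₂ θ / u₂ θ)) - k * π| ≤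
      |x - k * π| + |(φ - Real.arctan (deriv u₁ φ / u₁ φ)) - (φ - Real.arctan (deriv u₂ φ / u₂ φ))| := by
    have e : (φ - Real.arctan (deriv u₂ φ / u₂ φ)) - (θ - Real.arctan (deriv u₂ θ / u₂ θ)) - k * π =
        (x - k * π) - ((φ - Real.arctan (deriv u₁ φ / u₁ φ)) - (φ - Real.arctan (deriv u₂ φ / u₂ φ))) := by rw [hx]; ring
    rw [e]; exact abs_sub _ _
  have hkπ : |x - k * π| ≤ π / 2 * |ℓ| / ((B.Dtmin - κ₁) * B.umin) := by
    calc |x - k * π| ≤ π / 2 * |Real.sin x| := hk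
      _ ≤ π / 2 * (|ℓ| / ((B.Dtmin - κ₁) * B.umin)) := mul_le_mul_of_nonneg_left hsin (by positivity)
      _ = π / 2 * |ℓ| / ((B.Dtmin - κ₁) * B.umin) := by ring
  linarith

end Frame

end Summit.HubbardSuperconductivity.HubbardSuperconductivity.Theorems.PerturbedFermiCurve

end
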